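import Literature.AnabelianGeometry.SemiGraphs.FiniteEtaleCoveringGlobalDef
import Literature.AnabelianGeometry.SemiGraphs.FiniteEtaleCoveringDictionaryProofs4
import Literature.AnabelianGeometry.SemiGraphs.BranchSubgroupLemmas
import Literature.AnabelianGeometry.Anabelioids.FiniteEtaleBranchImage
import Literature.AnabelianGeometry.Anabelioids.FiniteEtaleLocalDictionaryStabilizer
import Literature.AnabelianGeometry.SemiGraphs.CommensurableTerminalityLemmas

/-!
# Branch frames of a morphism of semi-graphs of anabelioids: `ι(Π_{b′}) ≤ Π_b^{al}` ([SemiAnbd] Rem. 2.4.1/2.4.2) — toolkit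

Mochizuki, *Semi-graphs of anabelioids*, Publ. RIMS **42** (2006) 221–322, Def. 2.1 pp. 23–24
("the image of `Π_b` in `Π_v`, well-defined up to conjugation"), Rem. 2.2.1 p. 24, Rem. 2.4.1–2.4.2
p. 26 [cite: MochizukiSemiAnbd2006, Rem. 2.4.2 p.26].  abc-iut cell, layer L3, DISCHARGE-L3 §G row G30
(rulings μ2/π2, 2026-08-25; abc-iut-L4-t17).  Proof-only toolkit around the ALIGNED FRAME
`Hom.alignIso` / `Hom.alignedBranchSubgroup` of `FiniteEtaleCoveringGlobalDef`:

* group theory: `relIndex_eq_zero_of_map_le`, `eq_bot_of_map_le` (infinite index / triviality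
  descend along an injective homomorphism through a finite-index sandwich);
* `Anabelioids.index_range_pi1Map_ne_zero`: `[Π_e : Π_{e′}] < ∞` for a finite étale `φ_{e′}`
  (abc-iut-L6-t17's `range_pi1Map_eq_stabilizer` + `index_stabilizer_fiber`);
* `autMulEquivOfIso_alignIso_pi1Map` (the square `φ_{b′}` 2-commutes, pointwise) ⇒
  `map_branchSubgroup_le_aligned` — **`ι(Π_{b′}) ≤ Π_b^{al}` for ANY morphism** (no covering or
  alignment hypothesis) —, `map_branchSubgroup_eq_map_range_comp`,
  `relIndex_map_branchSubgroup_aligned_ne_zero` (finite index);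
* frame change: `branchSubgroup_isoWhiskerLeft_trans`, `branchSubgroup_eq_conjAct_smul_of_iso`
  (`Π_{b,1} = t Π_{b,2} t⁻¹`, `t = transportAut α₂ (b^*θ ≫ α₁)`);
* `map_branchSubgroup_eq_range_inf_aligned`: under `Hom.IsBranchAligned` (clause (i)),
  `ι(Π_{b′}) = ι(Π_{v′}) ∩ Π_b^{al}` — the equality form abc-iut-L3-t1's double-coset fact consumes.
Consumers: `CoveringEstrangedTransfer` (D7), the D6/D5 transports.  Nothing here takes a side on
[IUTchIII] Cor. 3.12; typed ≠ discharged.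
-/

/-! ## Transfer of aloofness / estrangement to branch-aligned finite étale coverings (D7 core) -/

namespace Literature.AnabelianGeometry

open CategoryTheory CategoryTheory.Functor CategoryTheory.PreGaloisCategory
open scoped Pointwise

universe u₁' u₂'

/-! ### Group theory: relative index along an injective homomorphism -/

section GroupTheory

variable {Γ' Γ : Type*} [Group Γ'] [Group Γ]

/-- Transfer of INFINITE relative index down an injective homomorphism through a finite-index
sandwich: if `ι(B′) ≤ B` with `[B : ι(B′)] < ∞`, `I′ ≤ B′`, `ι(I′) ≤ J` and `[B : J] = ∞`, then
`[B′ : I′] = ∞`. [cite: MochizukiSemiAnbd2006, Def. 2.4(iv) p.26] -/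
theorem relIndex_eq_zero_of_map_le (ι : Γ' →* Γ) (hι : Function.Injective ι)
    {I' B' : Subgroup Γ'} {J B : Subgroup Γ} (hI : I' ≤ B') (hB : B'.map ι ≤ B)
    (hfin : (B'.map ι).relIndex B ≠ 0) (hJ : I'.map ι ≤ J) (hJB : J.relIndex B = 0) :
    I'.relIndex B' = 0 := by
  have h1 : (I'.map ι).relIndex B = 0 := Subgroup.relIndex_eq_zero_of_le_left hJ hJB
  have h2 : (I'.map ι).relIndex (B'.map ι) * (B'.map ι).relIndex B = (I'.map ι).relIndex B :=
    Subgroup.relIndex_mul_relIndex _ _ _ (Subgroup.map_mono hI) hB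
  rw [h1, Subgroup.relIndex_map_map_of_injective I' B' hι] at h2
  rcases mul_eq_zero.mp h2 with h | h
  · exact h
  · exact absurd h hfin

/-- Transfer of TRIVIALITY down an injective homomorphism. [cite: MochizukiSemiAnbd2006, Def. 2.4(iv) p.26] -/
theorem eq_bot_of_map_le (ι : Γ' →* Γ) (hι : Function.Injective ι) {I' : Subgroup Γ'}
    {J : Subgroup Γ} (hJ : I'.map ι ≤ J) (hJb : J = ⊥) : I' = ⊥ := by
  rw [eq_bot_iff]
  intro x hx
  rw [Subgroup.mem_bot, ← map_eq_one_iff ι hι, ← Subgroup.mem_bot, ← hJb]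
  exact hJ ⟨x, hx, rfl⟩

end GroupTheory

namespace Anabelioids

/-! ### Finite index of `Π_{e′}` in `Π_e` for a finite étale `φ_{e′}` -/

section Index

variable {C : Type u₁'} [Category.{u₂'} C] [GaloisCategory C]
  {D : Type u₁'} [Category.{u₂'} D] [GaloisCategory D]

/-- For a finite étale pull-back `R ≅ (S × −) ⋙ α` onto a connected `S` and a basepoint `F` with
`R ⋙ F` a basepoint: `Im(π₁(R)) ⊆ Aut (R ⋙ F)` has FINITE (nonzero) index — it is the stabiliser of
the base point, of index the degree `|F(R S)|` ([SemiAnbd] Rem. 2.2.1).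
[cite: MochizukiSemiAnbd2006, Rem. 2.2.1 p.24] -/
theorem index_range_pi1Map_ne_zero (S : C) [IsConnected S] (α : Over S ⥤ D) [α.IsEquivalence]
    {R : C ⥤ D} (e : R ≅ Over.star S ⋙ α) (F : D ⥤ FintypeCat.{u₂'}) [FiberFunctor F]
    [FiberFunctor (R ⋙ F)] : (pi1Map R F).range.index ≠ 0 := by
  obtain ⟨x⟩ := nonempty_fiber_of_isConnected (R ⋙ F) S
  let t : F.obj (α.obj (Over.mk (𝟙 S))) :=
    F.map (α.map (Over.mkIdTerminal.from _)) (F.map (e.hom.app S) x)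
  have h := range_pi1Map_eq_stabilizer α e F (Iso.refl (R ⋙ F)) t
  have hrefl : (Aut.autMulEquivOfIso (Iso.refl (R ⋙ F))).toMonoidHom.comp (pi1Map R F) =
      pi1Map R F := by
    ext σ : 1
    refine Iso.ext ?_
    simp [Aut.autMulEquivOfIso]
  rw [hrefl] at h
  rw [h, index_stabilizer_fiber (R ⋙ F) S]
  exact Nat.card_pos.ne'

end Index

end Anabelioids

namespace SemiGraphs

open Literature.AnabelianGeometry.Anabelioids

universe v₁ u₁ u

namespace SemiGraphOfAnabelioids

variable {𝒢 𝒢' : SemiGraphOfAnabelioids.{v₁, u₁, u}}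

/-! ### The aligned frame: `ι(Π_{b′}) ≤ Π_b^{al}` with finite index -/

/-- The vertex components of the finite étale covering attached to `A` are finite étale onto a
CONNECTED component of `S_v` (vertex clause of `IsFiniteEtaleCoveringOf`).
[cite: MochizukiSemiAnbd2006, Def. 2.2(i) p.23] -/
theorem exists_iso_star_comp_φV (φ : Hom 𝒢' 𝒢) (A : 𝒢.BObj) (hφ : φ.IsFiniteEtaleCoveringOf A)
    (v' : 𝒢'.graph.Vertex) :
    ∃ (S : 𝒢.V (φ.base.vertexMap v')) (_ : PreGaloisCategory.IsConnected S)
      (α : Over S ⥤ 𝒢'.V v') (_ : α.IsEquivalence),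
      Nonempty ((φ.φV v').pullback ≅ Over.star S ⋙ α) := by
  obtain ⟨_, cV, _, _, _, hV, _, _⟩ := hφ
  obtain ⟨α, hα, hiso⟩ := hV v'
  exact ⟨_, (cV v').2, α, hα, hiso⟩

/-- **Pointwise alignment identity.** Conjugation by the aligned frame carries `π₁(b^* ⋙ φ_{e′}^*)(σ)`
to `ι(α′(π₁(b′^*)(σ)))`: the square `φ_{b′}` 2-commutes ([SemiAnbd] Rem. 2.4.2).
[cite: MochizukiSemiAnbd2006, Rem. 2.4.2 p.26] -/
theorem autMulEquivOfIso_alignIso_pi1Map (φ : Hom 𝒢' 𝒢) (b' : 𝒢'.graph.Branch)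
    (v' : 𝒢'.graph.Vertex) (h' : 𝒢'.graph.abuts b' = some v') (b : 𝒢.graph.Branch)
    (p : φ.base.branchMap b' = b) (F' : 𝒢'.V v' ⥤ FintypeCat.{v₁})
    (Fe' : 𝒢'.E (𝒢'.graph.edgeOf b') ⥤ FintypeCat.{v₁}) (α' : (𝒢'.pull b' v' h').pullback ⋙ Fe' ≅ F')
    (σ : Aut Fe') :
    Aut.autMulEquivOfIso (φ.alignIso b' v' h' b p F' Fe' α')
        (pi1Map (𝒢.pull b (φ.base.vertexMap v') (p ▸ φ.base.abuts_branchMap b' v' h')).pullback _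
          (pi1Map (φ.φE (𝒢'.graph.edgeOf b') (𝒢.graph.edgeOf b)
            (by rw [← p]; exact (φ.base.edgeOf_branchMap b').symm)).pullback Fe' σ)) =
      pi1Map (φ.φV v').pullback F'
        (Aut.autMulEquivOfIso α' (pi1Map (𝒢'.pull b' v' h').pullback Fe' σ)) := by
  subst p
  refine Iso.ext (NatTrans.ext (funext fun X => ?_))
  show (α'.inv.app ((φ.φV v').pullback.obj X) ≫ Fe'.map ((φ.φB b' v' h').hom.app X)) ≫
      σ.hom.app _ ≫ (Fe'.map ((φ.φB b' v' h').inv.app X) ≫ α'.hom.app ((φ.φV v').pullback.obj X)) =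
    α'.inv.app ((φ.φV v').pullback.obj X) ≫
      σ.hom.app ((𝒢'.pull b' v' h').pullback.obj ((φ.φV v').pullback.obj X)) ≫
        α'.hom.app ((φ.φV v').pullback.obj X)
  have nat : σ.hom.app _ ≫ Fe'.map ((φ.φB b' v' h').inv.app X) =
      Fe'.map ((φ.φB b' v' h').inv.app X) ≫ σ.hom.app _ := (σ.hom.naturality _).symm
  rw [Category.assoc, reassoc_of% nat]
  congr 1
  exact (Fe'.mapIso ((φ.φB b' v' h').app X)).hom_inv_id_assoc _

/-- **`ι(Π_{b′}) ≤ Π_b^{al}`**: the image of the branch subgroup of the covering lies in the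
aligned branch subgroup (abc-iut-L6-t17's `map_map_range_pi1Map_le_of_sq`, in the frame of
`Hom.alignedBranchSubgroup`). [cite: MochizukiSemiAnbd2006, Rem. 2.4.1 p.26] -/
theorem map_branchSubgroup_le_aligned (φ : Hom 𝒢' 𝒢) (b' : 𝒢'.graph.Branch)
    (v' : 𝒢'.graph.Vertex) (h' : 𝒢'.graph.abuts b' = some v') (b : 𝒢.graph.Branch)
    (p : φ.base.branchMap b' = b) (F' : 𝒢'.V v' ⥤ FintypeCat.{v₁})
    (Fe' : 𝒢'.E (𝒢'.graph.edgeOf b') ⥤ FintypeCat.{v₁}) (α' : (𝒢'.pull b' v' h').pullback ⋙ Fe' ≅ F') :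
    (𝒢'.branchSubgroup F' b' h' Fe' α').map (pi1Map (φ.φV v').pullback F') ≤
      φ.alignedBranchSubgroup b' v' h' b p F' Fe' α' := by
  rintro _ ⟨x, ⟨σ, rfl⟩, rfl⟩
  refine ⟨pi1Map (φ.φE (𝒢'.graph.edgeOf b') (𝒢.graph.edgeOf b)
    (by rw [← p]; exact (φ.base.edgeOf_branchMap b').symm)).pullback Fe' σ, ?_⟩
  exact autMulEquivOfIso_alignIso_pi1Map φ b' v' h' b p F' Fe' α' σ

/-- The image `ι(Π_{b′})` IS the aligned-frame image of `Im(π₁(b^* ⋙ φ_{e′}^*))`.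
[cite: MochizukiSemiAnbd2006, Rem. 2.4.1 p.26] -/
theorem map_branchSubgroup_eq_map_range_comp (φ : Hom 𝒢' 𝒢) (b' : 𝒢'.graph.Branch)
    (v' : 𝒢'.graph.Vertex) (h' : 𝒢'.graph.abuts b' = some v') (b : 𝒢.graph.Branch)
    (p : φ.base.branchMap b' = b) (F' : 𝒢'.V v' ⥤ FintypeCat.{v₁})
    (Fe' : 𝒢'.E (𝒢'.graph.edgeOf b') ⥤ FintypeCat.{v₁}) (α' : (𝒢'.pull b' v' h').pullback ⋙ Fe' ≅ F') :
    (𝒢'.branchSubgroup F' b' h' Fe' α').map (pi1Map (φ.φV v').pullback F') =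
      ((pi1Map (φ.φE (𝒢'.graph.edgeOf b') (𝒢.graph.edgeOf b)
            (by rw [← p]; exact (φ.base.edgeOf_branchMap b').symm)).pullback Fe').range.map
        (pi1Map (𝒢.pull b (φ.base.vertexMap v') (p ▸ φ.base.abuts_branchMap b' v' h')).pullback
          _)).map
        (Aut.autMulEquivOfIso (φ.alignIso b' v' h' b p F' Fe' α')).toMonoidHom := by
  ext y
  constructor
  · rintro ⟨x, ⟨σ, rfl⟩, rfl⟩
    exact ⟨_, ⟨_, ⟨σ, rfl⟩, rfl⟩, autMulEquivOfIso_alignIso_pi1Map φ b' v' h' b p F' Fe' α' σ⟩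
  · rintro ⟨_, ⟨_, ⟨σ, rfl⟩, rfl⟩, rfl⟩
    exact ⟨_, ⟨σ, rfl⟩, (autMulEquivOfIso_alignIso_pi1Map φ b' v' h' b p F' Fe' α' σ).symm⟩

/-- **Finite index `[Π_b^{al} : ι(Π_{b′})] < ∞`** when `Π_{e′}` has finite index in `Π_e`
(finite étale `φ_{e′}`). [cite: MochizukiSemiAnbd2006, Rem. 2.4.1 p.26] -/
theorem relIndex_map_branchSubgroup_aligned_ne_zero (φ : Hom 𝒢' 𝒢) (b' : 𝒢'.graph.Branch)
    (v' : 𝒢'.graph.Vertex) (h' : 𝒢'.graph.abuts b' = some v') (b : 𝒢.graph.Branch)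
    (p : φ.base.branchMap b' = b) (F' : 𝒢'.V v' ⥤ FintypeCat.{v₁})
    (Fe' : 𝒢'.E (𝒢'.graph.edgeOf b') ⥤ FintypeCat.{v₁}) (α' : (𝒢'.pull b' v' h').pullback ⋙ Fe' ≅ F')
    (hfin : (pi1Map (φ.φE (𝒢'.graph.edgeOf b') (𝒢.graph.edgeOf b)
      (by rw [← p]; exact (φ.base.edgeOf_branchMap b').symm)).pullback Fe').range.index ≠ 0) :
    ((𝒢'.branchSubgroup F' b' h' Fe' α').map (pi1Map (φ.φV v').pullback F')).relIndex
      (φ.alignedBranchSubgroup b' v' h' b p F' Fe' α') ≠ 0 := by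
  rw [map_branchSubgroup_eq_map_range_comp φ b' v' h' b p F' Fe' α', Hom.alignedBranchSubgroup,
    branchSubgroup_eq_map_range,
    Subgroup.relIndex_map_map_of_injective _ _ (Aut.autMulEquivOfIso _).injective]
  set P := (𝒢.pull b (φ.base.vertexMap v') (p ▸ φ.base.abuts_branchMap b' v' h')).pullback
  set R := (φ.φE (𝒢'.graph.edgeOf b') (𝒢.graph.edgeOf b)
    (by rw [← p]; exact (φ.base.edgeOf_branchMap b').symm)).pullback
  show ((pi1Map R Fe').range.map (pi1Map P (R ⋙ Fe'))).relIndex (pi1Map P (R ⋙ Fe')).range ≠ 0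
  rw [MonoidHom.range_eq_map (pi1Map P (R ⋙ Fe')), Subgroup.relIndex_map_map, top_sup_eq,
    Subgroup.relIndex_top_right]
  intro h0
  exact hfin (Nat.eq_zero_of_zero_dvd (h0 ▸ Subgroup.index_dvd_of_le le_sup_left))

/-- **Change of edge basepoint.** Replacing the edge basepoint `F_e` by an isomorphic one `F_e′`
(`θ : F_e′ ≅ F_e`) and the frame `α` by `b^*θ ≫ α` does not change the branch subgroup.
[cite: MochizukiSemiAnbd2006, Def. 2.1 pp.23-24] -/
theorem branchSubgroup_isoWhiskerLeft_trans (𝒢 : SemiGraphOfAnabelioids.{v₁, u₁, u})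
    {v : 𝒢.graph.Vertex} (F : 𝒢.V v ⥤ FintypeCat.{v₁}) (b : 𝒢.graph.Branch)
    (h : 𝒢.graph.abuts b = some v) {Fe Fe₂ : 𝒢.E (𝒢.graph.edgeOf b) ⥤ FintypeCat.{v₁}}
    (θ : Fe₂ ≅ Fe) (α : (𝒢.pull b v h).pullback ⋙ Fe ≅ F) :
    𝒢.branchSubgroup F b h Fe₂ (isoWhiskerLeft (𝒢.pull b v h).pullback θ ≪≫ α) =
      𝒢.branchSubgroup F b h Fe α := by
  have key : ∀ σ : Aut Fe₂,
      Aut.autMulEquivOfIso (isoWhiskerLeft (𝒢.pull b v h).pullback θ ≪≫ α)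
          (𝒢.piBToPiV b v h Fe₂ σ) =
        Aut.autMulEquivOfIso α (𝒢.piBToPiV b v h Fe (Aut.autMulEquivOfIso θ σ)) := by
    intro σ
    refine Iso.ext (NatTrans.ext (funext fun X => ?_))
    simp [Aut.autMulEquivOfIso, pi1Map_hom_app]
    erw [Category.assoc, Category.assoc]
    exact rfl
  ext x
  rw [mem_branchSubgroup_iff, mem_branchSubgroup_iff]
  constructor
  · rintro ⟨σ, rfl⟩
    exact ⟨Aut.autMulEquivOfIso θ σ, (key σ).symm⟩
  · rintro ⟨σ, rfl⟩
    refine ⟨Aut.autMulEquivOfIso θ.symm σ, ?_⟩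
    rw [key]
    congr 2
    refine Iso.ext ?_
    simp [Aut.autMulEquivOfIso]

/-- **Frame change.** Two frames `α₁ : b^* ⋙ F_{e,1} ≅ F`, `α₂ : b^* ⋙ F_{e,2} ≅ F` at isomorphic
edge basepoints (`θ : F_{e,2} ≅ F_{e,1}`) have CONJUGATE branch subgroups, by the explicit
transport element `t = α₂⁻¹ ≫ b^*θ ≫ α₁ ∈ Π_v` ("well-defined up to conjugation", Def. 2.1 p. 24).
[cite: MochizukiSemiAnbd2006, Def. 2.1 pp.23-24] -/
theorem branchSubgroup_eq_conjAct_smul_of_iso (𝒢 : SemiGraphOfAnabelioids.{v₁, u₁, u})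
    {v : 𝒢.graph.Vertex} (F : 𝒢.V v ⥤ FintypeCat.{v₁}) (b : 𝒢.graph.Branch)
    (h : 𝒢.graph.abuts b = some v) {Fe₁ Fe₂ : 𝒢.E (𝒢.graph.edgeOf b) ⥤ FintypeCat.{v₁}}
    (θ : Fe₂ ≅ Fe₁) (α₁ : (𝒢.pull b v h).pullback ⋙ Fe₁ ≅ F) (α₂ : (𝒢.pull b v h).pullback ⋙ Fe₂ ≅ F) :
    𝒢.branchSubgroup F b h Fe₁ α₁ =
      ConjAct.toConjAct (transportAut α₂ (isoWhiskerLeft (𝒢.pull b v h).pullback θ ≪≫ α₁)) •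
        𝒢.branchSubgroup F b h Fe₂ α₂ := by
  rw [← branchSubgroup_isoWhiskerLeft_trans 𝒢 F b h θ α₁, branchSubgroup_eq_conjAct_smul 𝒢 F b h Fe₂ α₂]

/-- **t1's equality form** (ruling μ2 / λ2): under branch alignment (i),
`ι(Π_{b′}) = ι(Π_{v′}) ∩ Π_b^{al}` — the branch group of the covering IS the intersection of the
(aligned) branch group of `𝒢` with the open subgroup `Π_{v′}` ([SemiAnbd] p. 23).
[cite: MochizukiSemiAnbd2006, Def. 2.2(i) p.23] -/
theorem map_branchSubgroup_eq_range_inf_aligned (φ : Hom 𝒢' 𝒢) (hal : φ.IsBranchAligned)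
    (b' : 𝒢'.graph.Branch) (v' : 𝒢'.graph.Vertex) (h' : 𝒢'.graph.abuts b' = some v')
    (b : 𝒢.graph.Branch) (p : φ.base.branchMap b' = b) (F' : 𝒢'.V v' ⥤ FintypeCat.{v₁})
    [PreGaloisCategory.FiberFunctor F'] (Fe' : 𝒢'.E (𝒢'.graph.edgeOf b') ⥤ FintypeCat.{v₁})
    [PreGaloisCategory.FiberFunctor Fe'] (α' : (𝒢'.pull b' v' h').pullback ⋙ Fe' ≅ F') :
    (𝒢'.branchSubgroup F' b' h' Fe' α').map (pi1Map (φ.φV v').pullback F') =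
      (pi1Map (φ.φV v').pullback F').range ⊓ φ.alignedBranchSubgroup b' v' h' b p F' Fe' α' := by
  refine le_antisymm (le_inf (Subgroup.map_le_range _ _)
    (map_branchSubgroup_le_aligned φ b' v' h' b p F' Fe' α')) ?_
  rintro x ⟨⟨u, rfl⟩, hx⟩
  exact ⟨u, (hal v' F' b).1 b' h' p Fe' α' (Subgroup.mem_comap.mpr hx), rfl⟩

end SemiGraphOfAnabelioids

end SemiGraphs

end Literature.AnabelianGeometry
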